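import Summits.HodgeConjecture.CorCM.HypLiu418.A3Liu418GSInstance
import Summits.HodgeConjecture.CorCM.B01.Transposition.HComp.HeckeTranslatesOfSec42DataOf
import Literature.NumberTheory.Automorphic.Liu2021.AppendixC.TowerMorphismCast
import Literature.NumberTheory.Automorphic.Liu2021.AppendixC.SeesawSource
import Literature.AlgebraicGeometry.ShimuraVarieties.UnitaryShimuraCurveEmbeddingPoints
import HarnessLib

/-!
# [Liu 2021, Thm 4.15 ∕ 4.18] GS-5b + GS-8core: the SEESAW SOURCE of the curve `Sh(U(J⋆), 𝔻)` — the tower morphism `towerHomGS`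
# into the rank-3 §4.2 datum and `seesawSourceGS`, a ★ `SeesawSource` over the EXPLICIT rank-3 carrier (+ its total-carrier twin), from a `RecordSystemGS` PARAMETER

Cell `hodgecm-mathlib` (D-0151), fan A, crux `HLiu418` (stmt-HodgeConjecture-24832), residual `stub_S34 : S34AtFace`, GS line
(A-plan2 memo `GS-PROGRAMME.md` A.16/A.17; A-plan1 KEY `gs5b-gs8core-seesaw-source`).  DEFINITION LANE (5 data defs by name + theorems);
NO named fact, NO instance, NO `sorry`; nothing of [Liu2021] is asserted — every input is either ★ or a HYPOTHESIS named after the ★ GS-2b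
predicates (`RecordSystemGS.HeckeTranslateDefinedOver` u1, `.EmbeddingDefinedOver` u2, `.IsLevelQuotient` u4).

* §1 `recordEmbedding` (CHOSEN from u2) · `isEmbedding_recordEmbedding` · `map_tr_record` — the record-level square
  `u⋆ ≫ ι_L ≫ T_{φ g} = T⋆_g ≫ ι_K` (★ GS-2b `embedding_comm_heckeTranslate` at the refined source level via ★ `IsEmbedding.map_comp`;
  target translate ★ `isHeckeTranslate_recordHeckeTranslate`).
* §2 **`towerHomGS`** : ★ `Sec42Data.TowerHom (sec42DataGS S h4 isoₛ) (sec42DataOfFourLe h V Φ h4 iso) (sec42HeckeTranslatesGS S hU7ₛ h4 isoₛ)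
  (sec42DataOfFourLe_heckeTranslates hU7 h V Φ h4 iso) (φGS …) (continuous_φGS …)` — `map K := (ι_{φ⁻¹K ∩ K₀⋆, K} ≫ recordFunctorOf_objIso⁻¹) ⊗_c F`,
  `map_tr` = `⊗_c` of §1 ([Milne2005ShimuraVarieties] Thm. 13.6 / Rem. 13.8; [Liu2021] Thm. 4.18 proof l. 2258–2290); `towerHomGS_map` (rfl);
  `nonempty_etaleTowerHomGS` (★ K-b).
* §3 **`towerHomGS_total`** — the same into the TOTAL carrier `sec42DataOf h iso F ι₁ V Φ` / `sec42DataOf_heckeTranslates …` (= `CV`/`TV` of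
  `A3Liu418Items` up to the face's `HodgeCM` repackaging) by ★ `Sec42Data.TowerHom.castTarget` (`TowerMorphismCast.lean`) along ★ `sec42DataOf_eq_of_four_le`.
* §4 **`seesawSourceGS`** : ★ `SeesawSource (sec42DataOfFourLe h V Φ h4 iso) (sec42DataOfFourLe_heckeTranslates hU7 h V Φ h4 iso) ℓ Pin` — the
  EXPLICIT carrier = the head carrier of F3 / the GS-8 closer (A-plan1 23:49:24Z «transport once»; A-p18 00:07:04Z) — with ALL eleven fields fed by
  name (`Cₛ := sec42DataGS`, `Tₛ := sec42HeckeTranslatesGS hU7ₛ`, `φ/hφ := φGS/continuous_φGS`, `M := towerHomGS` (NO cast),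
  `Xₛ := etaleHeckeDatumGS S hU7ₛ hLQ …` (GS-4: `hI_GS` + T4 `isogenyDescent_GS` inside), `hXₛ := isInducedBy_etaleHeckeDatumGS`, `pin := hpin` for a
  GENERIC `Pin`; `hK₀`, `hpin` binders = the two face discharges of the GS-8 closer); rfl read-outs `_Cₛ/_φ/_M/_Xₛ`; and the cheap
  total-carrier twin `seesawSourceGS_total` (`M := towerHomGS_total`).
* §5 `frobeniusActsBy_seesawSourceGS_iff` / `frobeniusActsBy_seesawSourceGS_total_iff` (`Iff.rfl`) — the M-UNPACKING: clause (2) of `S34SomeSource` for this source IS a statement over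
  `(sec42DataGS S h4 isoₛ).towerRep ℓ` and `(etaleHeckeDatumGS …).omegaHom ι (ρW.comp φGS)` — the token target of the GS-6 fact text.

RESIDUAL LIST (carrier level, A.17 of record): `seesawSourceGS` takes exactly {u1, u2, u4} (printed canonical-model properties of the CURVE,
[Deligne1979ShimuraVarieties] 2.2.5–2.2.6 / 2.7.1 (c), [Milne2005ShimuraVarieties] Thm. 13.6 / Rem. 5.29 (c) — conjuncts of the GS-3 cluster) + the face
discharges {`hK₀`, `hpin`}.  HC_CM is proved only modulo the 7 printed citations until rung 0 closes; this file closes nothing by itself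
(it is the carrier the GS-8 closer `s34SomeSource_of_GS` consumes together with GS-3, III-8′, GS-6).

References: [Liu2021] Y. Liu, Camb. J. Math. 9 (2021), §4.2 l. 2060–2074, Thm. 4.15 proof p. 51 (l. 2185–2213), Thm. 4.18 proof l. 2258–2290;
[Milne2005ShimuraVarieties] §5 p. 57–58, Thm. 13.6 p. 118, Rem. 13.8 p. 119; [Deligne1979ShimuraVarieties] 2.1.4, 2.2.5–2.2.6, 2.7.1, Cor. 2.7.21.
-/

set_option autoImplicit false

noncomputable section

namespace Summit.HodgeConjecture.CorCM.Lines.A3Liu418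

open CategoryTheory CategoryTheory.Limits AlgebraicGeometry NumberField
open Literature.AlgebraicGeometry.Motives
open Literature.AlgebraicGeometry.ShimuraVarieties.UnitaryCanonicalModel
open Literature.NumberTheory.Automorphic Literature.NumberTheory.Automorphic.UnitaryGroup
open Literature.NumberTheory.Automorphic.Liu2021 Literature.NumberTheory.Automorphic.Liu2021.AppendixC
open Summit.HodgeConjecture.CorCM.Model Summit.HodgeConjecture.CorCM.Model.HComp
open Summit.HodgeConjecture.CorCM.HComp
open IsDedekindDomain
open Literature.NumberTheory.GaloisRepresentations

variable {F : CMField} {ι₁ : F →+* ℂ} {Jstar : Matrix (Fin 2) (Fin 2) F}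
  {K₀ : C5.OpenCompactSubgroup ↥(finAdelic (↥(maximalRealSubfield F)) F (IsCMField.complexConj F) 2 Jstar)}
  (S : RecordSystemGS F Jstar ι₁ K₀)

/-! ## §1–§2 The tower morphism `towerHomGS` ([Milne2005ShimuraVarieties] Thm. 13.6) -/

section TowerHomGS

variable (h : exists_recordSystem) (hU7 : heckeTranslate_definedOver) (V : HermSpace3 F ι₁) (Φ : CMType F)
  (h4 : 4 ≤ Module.finrank ℚ F) (isoₛ iso : ℕ → Prop)
  (Jperp : Matrix (Fin 1) (Fin 1) F) (B : GL (Fin 3) F) {a : F} (ha : a ≠ 0)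
  (hB : formCongr ((IsCMField.complexConj F : F ≃ₐ[↥(maximalRealSubfield F)] F) : F →+* F) B (a • V.Hm) = finSum 2 1 Jstar Jperp)
  (hτa : 0 < (ι₁ a).re) (hτa' : (ι₁ a).im = 0)
  (hU7ₛ : S.HeckeTranslateDefinedOver) (hEmb : S.EmbeddingDefinedOver (recordOf h V h4) Jperp B ha hB hτa hτa')

/-- `ι_{K⋆, K} : M⋆_{K⋆} ⟶ M_K` CHOSEN from u2 `EmbeddingDefinedOver` (target: the chosen rank-3 record `recordOf h V h4`). -/
def recordEmbedding (Kstar : C5.SmallLevel K₀) (K : C5.SmallLevel (K3 V))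
    (hK : Kstar.1.1.map (φGS F Jstar Jperp V.Hm B ha hB) ≤ K.1.1) : S.M.obj Kstar ⟶ (recordOf h V h4).M.obj K :=
  (hEmb Kstar K hK).choose

/-- The chosen morphism IS an embedding. -/
theorem isEmbedding_recordEmbedding (Kstar : C5.SmallLevel K₀) (K : C5.SmallLevel (K3 V))
    (hK : Kstar.1.1.map (φGS F Jstar Jperp V.Hm B ha hB) ≤ K.1.1) :
    S.IsEmbedding (recordOf h V h4) Jperp B ha hB hτa hτa' Kstar K hK (recordEmbedding S h V h4 Jperp B ha hB hτa hτa' hEmb Kstar K hK) :=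
  (hEmb Kstar K hK).choose_spec

/-- **The record-level square behind `map_tr`**: for `g ∈ U(J⋆)(𝔸_f)`, an admissible target pair `(φ g)⁻¹ L (φ g) ⊆ K` and ANY
admissible source level `Lₛ ≤ φ⁻¹L ∩ K₀⋆` of `T⋆_g` into `φ⁻¹K ∩ K₀⋆`:
`u⋆_{Lₛ ≤ φ⁻¹L ∩ K₀⋆} ≫ ι_L ≫ T_{φ g} = T⋆_g ≫ ι_K` — B-typ02's `embedding_comm_heckeTranslate` at the refined source level
(`IsEmbedding.map_comp`), target translate ★ `isHeckeTranslate_recordHeckeTranslate`. -/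
theorem map_tr_record (g : ↥(finAdelic (↥(maximalRealSubfield F)) F (IsCMField.complexConj F) 2 Jstar))
    (L K : C5.SmallLevel (K3 V)) (hLK : C5.HeckeLE (φGS F Jstar Jperp V.Hm B ha hB g) L K)
    (Lₛ : C5.SmallLevel K₀)
    (hₛ : C5.HeckeLE g Lₛ (C5.pullbackLevel (φGS F Jstar Jperp V.Hm B ha hB) (continuous_φGS F Jstar Jperp V.Hm B ha hB) K₀ K))
    (hL : Lₛ ≤ C5.pullbackLevel (φGS F Jstar Jperp V.Hm B ha hB) (continuous_φGS F Jstar Jperp V.Hm B ha hB) K₀ L) :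
    S.M.map (homOfLE hL) ≫
        recordEmbedding S h V h4 Jperp B ha hB hτa hτa' hEmb _ L
          (C5.map_pullbackLevel_le (K₀ := K₀) (φGS F Jstar Jperp V.Hm B ha hB) (continuous_φGS F Jstar Jperp V.Hm B ha hB) L) ≫
        recordHeckeTranslate hU7 h V h4 (φGS F Jstar Jperp V.Hm B ha hB g) L K hLK =
      recordHeckeTranslateGS S hU7ₛ g Lₛ _ hₛ ≫
        recordEmbedding S h V h4 Jperp B ha hB hτa hτa' hEmb _ K
          (C5.map_pullbackLevel_le (K₀ := K₀) (φGS F Jstar Jperp V.Hm B ha hB) (continuous_φGS F Jstar Jperp V.Hm B ha hB) K) := by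
  have hLₛ : Lₛ.1.1.map (φGS F Jstar Jperp V.Hm B ha hB) ≤ L.1.1 :=
    (Subgroup.map_mono (show Lₛ.1.1 ≤ _ from hL)).trans
      (C5.map_pullbackLevel_le (K₀ := K₀) (φGS F Jstar Jperp V.Hm B ha hB) (continuous_φGS F Jstar Jperp V.Hm B ha hB) L)
  have hι : S.IsEmbedding (recordOf h V h4) Jperp B ha hB hτa hτa' Lₛ L hLₛ
      (S.M.map (homOfLE hL) ≫ recordEmbedding S h V h4 Jperp B ha hB hτa hτa' hEmb _ L
        (C5.map_pullbackLevel_le (K₀ := K₀) (φGS F Jstar Jperp V.Hm B ha hB) (continuous_φGS F Jstar Jperp V.Hm B ha hB) L)) :=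
    RecordSystemGS.IsEmbedding.map_comp S (recordOf h V h4) Jperp B ha hB hτa hτa' (homOfLE hL)
      (isEmbedding_recordEmbedding S h V h4 Jperp B ha hB hτa hτa' hEmb _ L _)
  have key := RecordSystemGS.embedding_comm_heckeTranslate S (recordOf h V h4) Jperp B ha hB hτa hτa' hι
    (isEmbedding_recordEmbedding S h V h4 Jperp B ha hB hτa hτa' hEmb _ K
      (C5.map_pullbackLevel_le (K₀ := K₀) (φGS F Jstar Jperp V.Hm B ha hB) (continuous_φGS F Jstar Jperp V.Hm B ha hB) K))
    (isHeckeTranslate_recordHeckeTranslateGS S hU7ₛ g Lₛ _ hₛ)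
    (isHeckeTranslate_recordHeckeTranslate hU7 h V h4 (φGS F Jstar Jperp V.Hm B ha hB g) L K hLK)
  simpa only [Category.assoc] using key

/-- **GS-5b JUNCTION: `towerHomGS`** — the ★ receptacle `Sec42Data.TowerHom` INHABITED at
(source) `sec42DataGS S h4 isoₛ` with translates `sec42HeckeTranslatesGS S hU7ₛ …`, (target) the explicit rank-3 honest datum
`sec42DataOfFourLe h V Φ h4 iso` with translates `sec42DataOfFourLe_heckeTranslates hU7 h V Φ h4 iso`, along
`φ := φGS` (`u ↦ R_B(u ⊕ 1)`): `map K := (ι_{φ⁻¹K ∩ K₀⋆, K} ≫ recordFunctorOf_objIso⁻¹) ⊗_c F`, `map_tr` := base change of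
`map_tr_record`.  Hypotheses: u1 `hU7ₛ`, u2 `hEmb` (GS-2b predicates of record), ★-facts `h`, `hU7` of the target. -/
def towerHomGS :
    Sec42Data.TowerHom (sec42DataGS S h4 isoₛ) (sec42DataOfFourLe h V Φ h4 iso) (sec42HeckeTranslatesGS S hU7ₛ h4 isoₛ)
      (sec42DataOfFourLe_heckeTranslates hU7 h V Φ h4 iso)
      (φGS F Jstar Jperp V.Hm B ha hB) (continuous_φGS F Jstar Jperp V.Hm B ha hB) where
  map K := (baseChangeHom (cmConjRingHom F)).map
    (recordEmbedding S h V h4 Jperp B ha hB hτa hτa' hEmb _ K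
        (C5.map_pullbackLevel_le (K₀ := K₀) (φGS F Jstar Jperp V.Hm B ha hB) (continuous_φGS F Jstar Jperp V.Hm B ha hB) K) ≫
      (recordFunctorOf_objIso h V h4 K).inv)
  map_tr g L K hLK Lₛ hₛ hL := by
    -- the record-level square, post-composed with `recordFunctorOf_objIso⁻¹` and base-changed along `c`
    have key := congrArg
      (fun f => (baseChangeHom (cmConjRingHom F)).map (f ≫ (recordFunctorOf_objIso h V h4 K).inv))
      (map_tr_record S h hU7 V h4 Jperp B ha hB hτa hτa' hU7ₛ hEmb g L K hLK Lₛ hₛ hL)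
    simp only [Functor.map_comp, Category.assoc] at key
    -- put every object in the `(· ⊗_c F)`-of-a-record form (the `Sec42Data.X`/`cpt` wrappers are `def`s), then cancel `iso⁻¹ ≫ iso`
    change (baseChangeHom (cmConjRingHom F)).map (S.M.map (homOfLE hL)) ≫
        (baseChangeHom (cmConjRingHom F)).map
            (recordEmbedding S h V h4 Jperp B ha hB hτa hτa' hEmb _ L
                (C5.map_pullbackLevel_le (K₀ := K₀) (φGS F Jstar Jperp V.Hm B ha hB)
                  (continuous_φGS F Jstar Jperp V.Hm B ha hB) L) ≫
              (recordFunctorOf_objIso h V h4 L).inv) ≫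
          (baseChangeHom (cmConjRingHom F)).map
            (recordFunctorHeckeTranslate hU7 h V h4 (φGS F Jstar Jperp V.Hm B ha hB g) L K hLK) =
      (baseChangeHom (cmConjRingHom F)).map (recordHeckeTranslateGS S hU7ₛ g Lₛ _ hₛ) ≫
        (baseChangeHom (cmConjRingHom F)).map
          (recordEmbedding S h V h4 Jperp B ha hB hτa hτa' hEmb _ K
              (C5.map_pullbackLevel_le (K₀ := K₀) (φGS F Jstar Jperp V.Hm B ha hB)
                (continuous_φGS F Jstar Jperp V.Hm B ha hB) K) ≫
            (recordFunctorOf_objIso h V h4 K).inv)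
    rw [recordFunctorHeckeTranslate]
    simp only [Functor.map_comp, Category.assoc, Iso.map_inv_hom_id_assoc]
    exact key

/-- Its `map K`, by `rfl`. -/
theorem towerHomGS_map (K : C5.SmallLevel (K3 V)) :
    (towerHomGS S h hU7 V Φ h4 isoₛ iso Jperp B ha hB hτa hτa' hU7ₛ hEmb).map K =
      (baseChangeHom (cmConjRingHom F)).map
        (recordEmbedding S h V h4 Jperp B ha hB hτa hτa' hEmb _ K
            (C5.map_pullbackLevel_le (K₀ := K₀) (φGS F Jstar Jperp V.Hm B ha hB) (continuous_φGS F Jstar Jperp V.Hm B ha hB) K) ≫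
          (recordFunctorOf_objIso h V h4 K).inv) := rfl


include hEmb in
/-- **(K-b by name)** the ÉTALE receptacle is inhabited too: `Nonempty (Sec42Data.EtaleTowerHom …)`. -/
theorem nonempty_etaleTowerHomGS :
    Nonempty (Sec42Data.EtaleTowerHom (sec42DataGS S h4 isoₛ) (sec42DataOfFourLe h V Φ h4 iso)
      (sec42HeckeTranslatesGS S hU7ₛ h4 isoₛ) (sec42DataOfFourLe_heckeTranslates hU7 h V Φ h4 iso)
      (φGS F Jstar Jperp V.Hm B ha hB) (continuous_φGS F Jstar Jperp V.Hm B ha hB)) :=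
  Sec42Data.nonempty_etaleTowerHom_of_towerHom ⟨towerHomGS S h hU7 V Φ h4 isoₛ iso Jperp B ha hB hτa hτa' hU7ₛ hEmb⟩

end TowerHomGS

/-! ## §3 On the chain's TOTAL carrier (★ `TowerHom.castTarget` along ★ `sec42DataOf_eq_of_four_le`) -/

section Total

variable (h : exists_recordSystem) (hU7 : heckeTranslate_definedOver) (V : HermSpace3 F ι₁) (Φ : CMType F)
  (iso : ∀ (F : CMField) (ι₁ : F →+* ℂ) (_ : HermSpace3 F ι₁) (_ : CMType F), ℕ → Prop)
  (h4 : 4 ≤ Module.finrank ℚ F) (isoₛ : ℕ → Prop)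
  (Jperp : Matrix (Fin 1) (Fin 1) F) (B : GL (Fin 3) F) {a : F} (ha : a ≠ 0)
  (hB : formCongr ((IsCMField.complexConj F : F ≃ₐ[↥(maximalRealSubfield F)] F) : F →+* F) B (a • V.Hm) = finSum 2 1 Jstar Jperp)
  (hτa : 0 < (ι₁ a).re) (hτa' : (ι₁ a).im = 0)
  (hU7ₛ : S.HeckeTranslateDefinedOver) (hEmb : S.EmbeddingDefinedOver (recordOf h V h4) Jperp B ha hB hτa hτa')

/-- **`towerHomGS` on the chain's TOTAL carrier** `sec42DataOf h iso F ι₁ V Φ` with `sec42DataOf_heckeTranslates hU7 h V Φ iso h4`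
(the `(CV, TV)` shape up to the face's `HodgeCM` repackaging), by transport along ★ `sec42DataOf_eq_of_four_le`. -/
def towerHomGS_total :
    Sec42Data.TowerHom (sec42DataGS S h4 isoₛ) (sec42DataOf h iso F ι₁ V Φ) (sec42HeckeTranslatesGS S hU7ₛ h4 isoₛ)
      (sec42DataOf_heckeTranslates hU7 h V Φ iso h4)
      (φGS F Jstar Jperp V.Hm B ha hB) (continuous_φGS F Jstar Jperp V.Hm B ha hB) :=
  Sec42Data.TowerHom.castTarget (sec42DataOf_eq_of_four_le h V Φ iso h4)
    (towerHomGS S h hU7 V Φ h4 isoₛ (iso F ι₁ V Φ) Jperp B ha hB hτa hτa' hU7ₛ hEmb)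

include hEmb in
/-- Hence the étale receptacle over the total carrier is inhabited. -/
theorem nonempty_etaleTowerHomGS_total :
    Nonempty (Sec42Data.EtaleTowerHom (sec42DataGS S h4 isoₛ) (sec42DataOf h iso F ι₁ V Φ)
      (sec42HeckeTranslatesGS S hU7ₛ h4 isoₛ) (sec42DataOf_heckeTranslates hU7 h V Φ iso h4)
      (φGS F Jstar Jperp V.Hm B ha hB) (continuous_φGS F Jstar Jperp V.Hm B ha hB)) :=
  Sec42Data.nonempty_etaleTowerHom_of_towerHom
    ⟨towerHomGS_total S h hU7 V Φ iso h4 isoₛ Jperp B ha hB hτa hτa' hU7ₛ hEmb⟩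

end Total

/-! ## §4 The seesaw source over the EXPLICIT carrier (F3's / the closer's head carrier) and its read-outs; §5 M-unpacking -/

section SeesawExplicit

variable (h : exists_recordSystem) (hU7 : heckeTranslate_definedOver) (V : HermSpace3 F ι₁) (Φ : CMType F)
  (h4 : 4 ≤ Module.finrank ℚ F) (isoₛ iso : ℕ → Prop)
  (Jperp : Matrix (Fin 1) (Fin 1) F) (B : GL (Fin 3) F) {a : F} (ha : a ≠ 0)
  (hB : formCongr ((IsCMField.complexConj F : F ≃ₐ[↥(maximalRealSubfield F)] F) : F →+* F) B (a • V.Hm) = finSum 2 1 Jstar Jperp)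
  (hτa : 0 < (ι₁ a).re) (hτa' : (ι₁ a).im = 0)
  (hU7ₛ : S.HeckeTranslateDefinedOver) (hEmb : S.EmbeddingDefinedOver (recordOf h V h4) Jperp B ha hB hτa hτa')
  (hLQ : S.IsLevelQuotient) (ℓ : ℕ) [Fact ℓ.Prime]

/-- **GS-8 core: `seesawSourceGS` — the SEESAW SOURCE of the curve over the EXPLICIT rank-3 carrier** `(sec42DataOfFourLe h V Φ h4 iso, sec42DataOfFourLe_heckeTranslates …)` (the head carrier of F3 `A3Liu418S34ClauseOneTarget` and of the GS-8 closer; `M := towerHomGS`, NO cast).  ALL eleven fields of ★ `SeesawSource` fed BY NAME: `Cₛ := sec42DataGS S h4 isoₛ`,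
`Tₛ := sec42HeckeTranslatesGS S hU7ₛ h4 isoₛ` (u1), `φ := φGS` / `hφ := continuous_φGS` (`u ↦ R_B(u ⊕ 1)`), `hK₀` (binder; the face takes
`K₀⋆ := restrict φGS K₁ (K3 V)`, ★ G5), `M := towerHomGS …` (u2), `Xₛ := etaleHeckeDatumGS S hU7ₛ hLQ h4 isoₛ ℓ` (GS-4: ★ `etaleHeckeDatumOfTranslates` at
`hI_GS`, `isogenyDescent_GS` — u1 + u4), `hXₛ := isInducedBy_etaleHeckeDatumGS …`, `pin := hpin` for a GENERIC `Pin` (binder; the v18 registry fills it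
with the bare `FacePinData` constructor, (D-ii′)).  Hypotheses therefore = {u1 `hU7ₛ`, u2 `hEmb`, u4 `hLQ`} + face discharges {`hK₀`, `hpin`}.
[cite: Liu2021, Thm. 4.15 proof p. 51 (FJcycle.tex l. 2193–2212); Thm. 4.18 proof l. 2258–2290] [cite: Milne2005ShimuraVarieties, Thm. 13.6 p. 118]
[cite: Deligne1979ShimuraVarieties, 2.2.5–2.2.6 and 2.7.1 (c)] -/
def seesawSourceGS
    (Pin : ∀ {P5ₛ : PropC5Data (↥(maximalRealSubfield F)) F} {isoₛ : ℕ → Prop} (Cₛ : Sec42Data P5ₛ isoₛ),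
      (Cₛ.G →* (sec42DataOfFourLe h V Φ h4 iso).G) → Prop)
    (hK₀ : ((sec42DataGS S h4 isoₛ).S.K₀.1 : Subgroup (sec42DataGS S h4 isoₛ).G).map (φGS F Jstar Jperp V.Hm B ha hB) ≤
      (sec42DataOfFourLe h V Φ h4 iso).S.K₀.1)
    (hpin : Pin (sec42DataGS S h4 isoₛ) (φGS F Jstar Jperp V.Hm B ha hB)) :
    SeesawSource (sec42DataOfFourLe h V Φ h4 iso) (sec42DataOfFourLe_heckeTranslates hU7 h V Φ h4 iso) ℓ Pin where
  P5ₛ := honestP5GS Jstar K₀ S.M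
  isoₛ := isoₛ
  Cₛ := sec42DataGS S h4 isoₛ
  Tₛ := sec42HeckeTranslatesGS S hU7ₛ h4 isoₛ
  φ := φGS F Jstar Jperp V.Hm B ha hB
  hφ := continuous_φGS F Jstar Jperp V.Hm B ha hB
  hK₀ := hK₀
  M := towerHomGS S h hU7 V Φ h4 isoₛ iso Jperp B ha hB hτa hτa' hU7ₛ hEmb
  Xₛ := etaleHeckeDatumGS S hU7ₛ hLQ h4 isoₛ ℓ
  hXₛ := isInducedBy_etaleHeckeDatumGS S hU7ₛ hLQ h4 isoₛ ℓ
  pin := hpin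

/-- Read-out: the source §4.2 datum of `seesawSourceGS` is `sec42DataGS S h4 isoₛ` (`rfl`). [cite: Liu2021, §4.2 l. 2060–2074] -/
theorem seesawSourceGS_Cₛ
    (Pin : ∀ {P5ₛ : PropC5Data (↥(maximalRealSubfield F)) F} {isoₛ : ℕ → Prop} (Cₛ : Sec42Data P5ₛ isoₛ),
      (Cₛ.G →* (sec42DataOfFourLe h V Φ h4 iso).G) → Prop)
    (hK₀ : ((sec42DataGS S h4 isoₛ).S.K₀.1 : Subgroup (sec42DataGS S h4 isoₛ).G).map (φGS F Jstar Jperp V.Hm B ha hB) ≤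
      (sec42DataOfFourLe h V Φ h4 iso).S.K₀.1)
    (hpin : Pin (sec42DataGS S h4 isoₛ) (φGS F Jstar Jperp V.Hm B ha hB)) :
    (seesawSourceGS S h hU7 V Φ h4 isoₛ iso Jperp B ha hB hτa hτa' hU7ₛ hEmb hLQ ℓ Pin hK₀ hpin).Cₛ = sec42DataGS S h4 isoₛ := rfl

/-- Read-out: its group map is `φGS` (`rfl`). [cite: Liu2021, Thm. 4.15 proof (FJcycle.tex l. 2193–2203)] -/
theorem seesawSourceGS_φ
    (Pin : ∀ {P5ₛ : PropC5Data (↥(maximalRealSubfield F)) F} {isoₛ : ℕ → Prop} (Cₛ : Sec42Data P5ₛ isoₛ),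
      (Cₛ.G →* (sec42DataOfFourLe h V Φ h4 iso).G) → Prop)
    (hK₀ : ((sec42DataGS S h4 isoₛ).S.K₀.1 : Subgroup (sec42DataGS S h4 isoₛ).G).map (φGS F Jstar Jperp V.Hm B ha hB) ≤
      (sec42DataOfFourLe h V Φ h4 iso).S.K₀.1)
    (hpin : Pin (sec42DataGS S h4 isoₛ) (φGS F Jstar Jperp V.Hm B ha hB)) :
    (seesawSourceGS S h hU7 V Φ h4 isoₛ iso Jperp B ha hB hτa hτa' hU7ₛ hEmb hLQ ℓ Pin hK₀ hpin).φ = φGS F Jstar Jperp V.Hm B ha hB := rfl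

/-- Read-out: its tower morphism (`rfl`). [cite: Milne2005ShimuraVarieties, Thm. 13.6 p. 118] -/
theorem seesawSourceGS_M
    (Pin : ∀ {P5ₛ : PropC5Data (↥(maximalRealSubfield F)) F} {isoₛ : ℕ → Prop} (Cₛ : Sec42Data P5ₛ isoₛ),
      (Cₛ.G →* (sec42DataOfFourLe h V Φ h4 iso).G) → Prop)
    (hK₀ : ((sec42DataGS S h4 isoₛ).S.K₀.1 : Subgroup (sec42DataGS S h4 isoₛ).G).map (φGS F Jstar Jperp V.Hm B ha hB) ≤
      (sec42DataOfFourLe h V Φ h4 iso).S.K₀.1)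
    (hpin : Pin (sec42DataGS S h4 isoₛ) (φGS F Jstar Jperp V.Hm B ha hB)) :
    (seesawSourceGS S h hU7 V Φ h4 isoₛ iso Jperp B ha hB hτa hτa' hU7ₛ hEmb hLQ ℓ Pin hK₀ hpin).M = towerHomGS S h hU7 V Φ h4 isoₛ iso Jperp B ha hB hτa hτa' hU7ₛ hEmb := rfl

/-- Read-out: its étale Hecke datum is GS-4's `etaleHeckeDatumGS` (`rfl`). [cite: Liu2021, §4.3 (FJcycle.tex l. 2154–2160)] -/
theorem seesawSourceGS_Xₛ
    (Pin : ∀ {P5ₛ : PropC5Data (↥(maximalRealSubfield F)) F} {isoₛ : ℕ → Prop} (Cₛ : Sec42Data P5ₛ isoₛ),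
      (Cₛ.G →* (sec42DataOfFourLe h V Φ h4 iso).G) → Prop)
    (hK₀ : ((sec42DataGS S h4 isoₛ).S.K₀.1 : Subgroup (sec42DataGS S h4 isoₛ).G).map (φGS F Jstar Jperp V.Hm B ha hB) ≤
      (sec42DataOfFourLe h V Φ h4 iso).S.K₀.1)
    (hpin : Pin (sec42DataGS S h4 isoₛ) (φGS F Jstar Jperp V.Hm B ha hB)) :
    (seesawSourceGS S h hU7 V Φ h4 isoₛ iso Jperp B ha hB hτa hτa' hU7ₛ hEmb hLQ ℓ Pin hK₀ hpin).Xₛ = etaleHeckeDatumGS S hU7ₛ hLQ h4 isoₛ ℓ := rfl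

/-- **M-UNPACKING (`Iff.rfl`)**: `FrobeniusActsBy` of `seesawSourceGS` IS the following statement over the ★-built carriers
`(sec42DataGS S h4 isoₛ).towerRep ℓ` and `(etaleHeckeDatumGS …).omegaHom ι (ρW.comp φGS)` — token-for-token the conclusion the GS-6 text
(`frobeniusActsByGS`, [Liu2021] Rem. D.5 / Thm. D.6 (1) on the curve) must produce so that clause (2) of the GS-8 closer is `(…_iff …).2 (hGS6 …)`.
[cite: Liu2021, App. D Rem. D.5 p. 131, Thm. D.6 (1) p. 132] -/
theorem frobeniusActsBy_seesawSourceGS_iff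
    (Pin : ∀ {P5ₛ : PropC5Data (↥(maximalRealSubfield F)) F} {isoₛ : ℕ → Prop} (Cₛ : Sec42Data P5ₛ isoₛ),
      (Cₛ.G →* (sec42DataOfFourLe h V Φ h4 iso).G) → Prop)
    (hK₀ : ((sec42DataGS S h4 isoₛ).S.K₀.1 : Subgroup (sec42DataGS S h4 isoₛ).G).map (φGS F Jstar Jperp V.Hm B ha hB) ≤
      (sec42DataOfFourLe h V Φ h4 iso).S.K₀.1)
    (hpin : Pin (sec42DataGS S h4 isoₛ) (φGS F Jstar Jperp V.Hm B ha hB))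
    (ι : ℂ ≃+* AlgebraicClosure ℚ_[ℓ]) {W : Type} [AddCommGroup W] [Module ℂ W]
    (ρW : Representation ℂ (sec42DataOfFourLe h V Φ h4 iso).G W) (cOf : HeightOneSpectrum (𝓞 F) → AlgebraicClosure ℚ_[ℓ]) :
    (seesawSourceGS S h hU7 V Φ h4 isoₛ iso Jperp B ha hB hτa hτa' hU7ₛ hEmb hLQ ℓ Pin hK₀ hpin).FrobeniusActsBy ι ρW cOf ↔
      ∃ Sbad : Set (HeightOneSpectrum (𝓞 F)), Sbad.Finite ∧
        ∀ v ∉ Sbad, ∀ 𝔓 ∈ v.primesAbove, ∀ σ : Field.absoluteGaloisGroup F, IsArithFrobAt (𝓞 F) σ 𝔓 →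
          ∀ f' ∈ (etaleHeckeDatumGS S hU7ₛ hLQ h4 isoₛ ℓ).omegaHom ι (ρW.comp (φGS F Jstar Jperp V.Hm B ha hB)), ∀ w : W,
            ((sec42DataGS S h4 isoₛ).towerRep ℓ σ).baseChange (AlgebraicClosure ℚ_[ℓ]) (f' w) = cOf v • f' w :=
  Iff.rfl

end SeesawExplicit

/-! ## §4′/§5′ The total-carrier twin -/

section SeesawTotal

variable (h : exists_recordSystem) (hU7 : heckeTranslate_definedOver) (V : HermSpace3 F ι₁) (Φ : CMType F)
  (iso : ∀ (F : CMField) (ι₁ : F →+* ℂ) (_ : HermSpace3 F ι₁) (_ : CMType F), ℕ → Prop)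
  (h4 : 4 ≤ Module.finrank ℚ F) (isoₛ : ℕ → Prop)
  (Jperp : Matrix (Fin 1) (Fin 1) F) (B : GL (Fin 3) F) {a : F} (ha : a ≠ 0)
  (hB : formCongr ((IsCMField.complexConj F : F ≃ₐ[↥(maximalRealSubfield F)] F) : F →+* F) B (a • V.Hm) = finSum 2 1 Jstar Jperp)
  (hτa : 0 < (ι₁ a).re) (hτa' : (ι₁ a).im = 0)
  (hU7ₛ : S.HeckeTranslateDefinedOver) (hEmb : S.EmbeddingDefinedOver (recordOf h V h4) Jperp B ha hB hτa hτa')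
  (hLQ : S.IsLevelQuotient) (ℓ : ℕ) [Fact ℓ.Prime]

/-- **`seesawSourceGS_total` — the same source over the chain's TOTAL carrier** `(sec42DataOf h iso F ι₁ V Φ, sec42DataOf_heckeTranslates …)` (= `CV`/`TV` of `A3Liu418Items` up to the face's `HodgeCM` repackaging; `M := towerHomGS_total`, ★ `TowerHom.castTarget` along ★ `sec42DataOf_eq_of_four_le`) — cheap capital; the closer uses the explicit form and transports ONCE (`S34SomeSource.forall_transport`).  ALL eleven fields of ★ `SeesawSource` fed BY NAME: `Cₛ := sec42DataGS S h4 isoₛ`,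
`Tₛ := sec42HeckeTranslatesGS S hU7ₛ h4 isoₛ` (u1), `φ := φGS` / `hφ := continuous_φGS` (`u ↦ R_B(u ⊕ 1)`), `hK₀` (binder; the face takes
`K₀⋆ := restrict φGS K₁ (K3 V)`, ★ G5), `M := towerHomGS_total …` (u2), `Xₛ := etaleHeckeDatumGS S hU7ₛ hLQ h4 isoₛ ℓ` (GS-4: ★ `etaleHeckeDatumOfTranslates` at
`hI_GS`, `isogenyDescent_GS` — u1 + u4), `hXₛ := isInducedBy_etaleHeckeDatumGS …`, `pin := hpin` for a GENERIC `Pin` (binder; the v18 registry fills it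
with the bare `FacePinData` constructor, (D-ii′)).  Hypotheses therefore = {u1 `hU7ₛ`, u2 `hEmb`, u4 `hLQ`} + face discharges {`hK₀`, `hpin`}.
[cite: Liu2021, Thm. 4.15 proof p. 51 (FJcycle.tex l. 2193–2212); Thm. 4.18 proof l. 2258–2290] [cite: Milne2005ShimuraVarieties, Thm. 13.6 p. 118]
[cite: Deligne1979ShimuraVarieties, 2.2.5–2.2.6 and 2.7.1 (c)] -/
def seesawSourceGS_total
    (Pin : ∀ {P5ₛ : PropC5Data (↥(maximalRealSubfield F)) F} {isoₛ : ℕ → Prop} (Cₛ : Sec42Data P5ₛ isoₛ),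
      (Cₛ.G →* (sec42DataOf h iso F ι₁ V Φ).G) → Prop)
    (hK₀ : ((sec42DataGS S h4 isoₛ).S.K₀.1 : Subgroup (sec42DataGS S h4 isoₛ).G).map (φGS F Jstar Jperp V.Hm B ha hB) ≤
      (sec42DataOf h iso F ι₁ V Φ).S.K₀.1)
    (hpin : Pin (sec42DataGS S h4 isoₛ) (φGS F Jstar Jperp V.Hm B ha hB)) :
    SeesawSource (sec42DataOf h iso F ι₁ V Φ) (sec42DataOf_heckeTranslates hU7 h V Φ iso h4) ℓ Pin where
  P5ₛ := honestP5GS Jstar K₀ S.M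
  isoₛ := isoₛ
  Cₛ := sec42DataGS S h4 isoₛ
  Tₛ := sec42HeckeTranslatesGS S hU7ₛ h4 isoₛ
  φ := φGS F Jstar Jperp V.Hm B ha hB
  hφ := continuous_φGS F Jstar Jperp V.Hm B ha hB
  hK₀ := hK₀
  M := towerHomGS_total S h hU7 V Φ iso h4 isoₛ Jperp B ha hB hτa hτa' hU7ₛ hEmb
  Xₛ := etaleHeckeDatumGS S hU7ₛ hLQ h4 isoₛ ℓ
  hXₛ := isInducedBy_etaleHeckeDatumGS S hU7ₛ hLQ h4 isoₛ ℓ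
  pin := hpin

/-- Read-out: the source §4.2 datum of `seesawSourceGS_total` is `sec42DataGS S h4 isoₛ` (`rfl`). [cite: Liu2021, §4.2 l. 2060–2074] -/
theorem seesawSourceGS_total_Cₛ
    (Pin : ∀ {P5ₛ : PropC5Data (↥(maximalRealSubfield F)) F} {isoₛ : ℕ → Prop} (Cₛ : Sec42Data P5ₛ isoₛ),
      (Cₛ.G →* (sec42DataOf h iso F ι₁ V Φ).G) → Prop)
    (hK₀ : ((sec42DataGS S h4 isoₛ).S.K₀.1 : Subgroup (sec42DataGS S h4 isoₛ).G).map (φGS F Jstar Jperp V.Hm B ha hB) ≤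
      (sec42DataOf h iso F ι₁ V Φ).S.K₀.1)
    (hpin : Pin (sec42DataGS S h4 isoₛ) (φGS F Jstar Jperp V.Hm B ha hB)) :
    (seesawSourceGS_total S h hU7 V Φ iso h4 isoₛ Jperp B ha hB hτa hτa' hU7ₛ hEmb hLQ ℓ Pin hK₀ hpin).Cₛ = sec42DataGS S h4 isoₛ := rfl

/-- Read-out: its group map is `φGS` (`rfl`). [cite: Liu2021, Thm. 4.15 proof (FJcycle.tex l. 2193–2203)] -/
theorem seesawSourceGS_total_φ
    (Pin : ∀ {P5ₛ : PropC5Data (↥(maximalRealSubfield F)) F} {isoₛ : ℕ → Prop} (Cₛ : Sec42Data P5ₛ isoₛ),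
      (Cₛ.G →* (sec42DataOf h iso F ι₁ V Φ).G) → Prop)
    (hK₀ : ((sec42DataGS S h4 isoₛ).S.K₀.1 : Subgroup (sec42DataGS S h4 isoₛ).G).map (φGS F Jstar Jperp V.Hm B ha hB) ≤
      (sec42DataOf h iso F ι₁ V Φ).S.K₀.1)
    (hpin : Pin (sec42DataGS S h4 isoₛ) (φGS F Jstar Jperp V.Hm B ha hB)) :
    (seesawSourceGS_total S h hU7 V Φ iso h4 isoₛ Jperp B ha hB hτa hτa' hU7ₛ hEmb hLQ ℓ Pin hK₀ hpin).φ = φGS F Jstar Jperp V.Hm B ha hB := rfl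

/-- Read-out: its tower morphism (`rfl`). [cite: Milne2005ShimuraVarieties, Thm. 13.6 p. 118] -/
theorem seesawSourceGS_total_M
    (Pin : ∀ {P5ₛ : PropC5Data (↥(maximalRealSubfield F)) F} {isoₛ : ℕ → Prop} (Cₛ : Sec42Data P5ₛ isoₛ),
      (Cₛ.G →* (sec42DataOf h iso F ι₁ V Φ).G) → Prop)
    (hK₀ : ((sec42DataGS S h4 isoₛ).S.K₀.1 : Subgroup (sec42DataGS S h4 isoₛ).G).map (φGS F Jstar Jperp V.Hm B ha hB) ≤
      (sec42DataOf h iso F ι₁ V Φ).S.K₀.1)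
    (hpin : Pin (sec42DataGS S h4 isoₛ) (φGS F Jstar Jperp V.Hm B ha hB)) :
    (seesawSourceGS_total S h hU7 V Φ iso h4 isoₛ Jperp B ha hB hτa hτa' hU7ₛ hEmb hLQ ℓ Pin hK₀ hpin).M = towerHomGS_total S h hU7 V Φ iso h4 isoₛ Jperp B ha hB hτa hτa' hU7ₛ hEmb := rfl

/-- Read-out: its étale Hecke datum is GS-4's `etaleHeckeDatumGS` (`rfl`). [cite: Liu2021, §4.3 (FJcycle.tex l. 2154–2160)] -/
theorem seesawSourceGS_total_Xₛ
    (Pin : ∀ {P5ₛ : PropC5Data (↥(maximalRealSubfield F)) F} {isoₛ : ℕ → Prop} (Cₛ : Sec42Data P5ₛ isoₛ),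
      (Cₛ.G →* (sec42DataOf h iso F ι₁ V Φ).G) → Prop)
    (hK₀ : ((sec42DataGS S h4 isoₛ).S.K₀.1 : Subgroup (sec42DataGS S h4 isoₛ).G).map (φGS F Jstar Jperp V.Hm B ha hB) ≤
      (sec42DataOf h iso F ι₁ V Φ).S.K₀.1)
    (hpin : Pin (sec42DataGS S h4 isoₛ) (φGS F Jstar Jperp V.Hm B ha hB)) :
    (seesawSourceGS_total S h hU7 V Φ iso h4 isoₛ Jperp B ha hB hτa hτa' hU7ₛ hEmb hLQ ℓ Pin hK₀ hpin).Xₛ = etaleHeckeDatumGS S hU7ₛ hLQ h4 isoₛ ℓ := rfl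

/-- **M-UNPACKING (`Iff.rfl`)**: `FrobeniusActsBy` of `seesawSourceGS_total` IS the following statement over the ★-built carriers
`(sec42DataGS S h4 isoₛ).towerRep ℓ` and `(etaleHeckeDatumGS …).omegaHom ι (ρW.comp φGS)` — token-for-token the conclusion the GS-6 text
(`frobeniusActsByGS`, [Liu2021] Rem. D.5 / Thm. D.6 (1) on the curve) must produce so that clause (2) of the GS-8 closer is `(…_iff …).2 (hGS6 …)`.
[cite: Liu2021, App. D Rem. D.5 p. 131, Thm. D.6 (1) p. 132] -/
theorem frobeniusActsBy_seesawSourceGS_total_iff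
    (Pin : ∀ {P5ₛ : PropC5Data (↥(maximalRealSubfield F)) F} {isoₛ : ℕ → Prop} (Cₛ : Sec42Data P5ₛ isoₛ),
      (Cₛ.G →* (sec42DataOf h iso F ι₁ V Φ).G) → Prop)
    (hK₀ : ((sec42DataGS S h4 isoₛ).S.K₀.1 : Subgroup (sec42DataGS S h4 isoₛ).G).map (φGS F Jstar Jperp V.Hm B ha hB) ≤
      (sec42DataOf h iso F ι₁ V Φ).S.K₀.1)
    (hpin : Pin (sec42DataGS S h4 isoₛ) (φGS F Jstar Jperp V.Hm B ha hB))
    (ι : ℂ ≃+* AlgebraicClosure ℚ_[ℓ]) {W : Type} [AddCommGroup W] [Module ℂ W]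
    (ρW : Representation ℂ (sec42DataOf h iso F ι₁ V Φ).G W) (cOf : HeightOneSpectrum (𝓞 F) → AlgebraicClosure ℚ_[ℓ]) :
    (seesawSourceGS_total S h hU7 V Φ iso h4 isoₛ Jperp B ha hB hτa hτa' hU7ₛ hEmb hLQ ℓ Pin hK₀ hpin).FrobeniusActsBy ι ρW cOf ↔
      ∃ Sbad : Set (HeightOneSpectrum (𝓞 F)), Sbad.Finite ∧
        ∀ v ∉ Sbad, ∀ 𝔓 ∈ v.primesAbove, ∀ σ : Field.absoluteGaloisGroup F, IsArithFrobAt (𝓞 F) σ 𝔓 →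
          ∀ f' ∈ (etaleHeckeDatumGS S hU7ₛ hLQ h4 isoₛ ℓ).omegaHom ι (ρW.comp (φGS F Jstar Jperp V.Hm B ha hB)), ∀ w : W,
            ((sec42DataGS S h4 isoₛ).towerRep ℓ σ).baseChange (AlgebraicClosure ℚ_[ℓ]) (f' w) = cOf v • f' w :=
  Iff.rfl

end SeesawTotal

end Summit.HodgeConjecture.CorCM.Lines.A3Liu418

end
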